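import Mathlib
import Summits.RiemannHypothesis.RiemannHypothesis.Theorems.WeilFormatCPrimeFormBound
import Summits.RiemannHypothesis.RiemannHypothesis.Theorems.WeilFormatCPrimeFormJoint
import HarnessLib

/-!
# Format C: the PRIME block of Yoshida's Gram matrix is `⪰ −A·1` for ANY certified joint shift constant `A`

Helper file (`--supports stmt-RiemannHypothesis-0098`, lead-track anchor; format C far bound), RH-free.  Seat
rh-explicit-weil-1 (gen3).  `WeilFormatCPrimeFormJoint.lean` proved the prime-form bound with the constant `2387/1000`
of the first joint-phantom certificate `JointSOS.certA10397` hard-wired.  This file separates the bookkeeping from the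
certificate: for every window `0 < a ≤ 10397/10000` (`e^{2a} < 8`, window prime powers `2, 3, 4, 5, 7`) and every
real constant `A` for which the REAL five-term joint shift bound

  `Σ_{n=2,3,4,5,7} 2(Λ(n)/√n) ∫ u(x − log n) u(x) dx ≤ A · ∫ u²`
  (all real measurable bounded `u` vanishing off `[−a, a]`)

holds,

* `WeilFormatC.primeCoeff_form_ge_of_jointShiftBound` —
  **`−A · Σ_{n∈s} |c_n|² ≤ Σ_{n,m∈s} Re(conj c_n · c_m) · primeCoeff a n m`** for every finite `s ⊆ ℤ`, `c : ℤ → ℂ`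

(hypothesis `hP` of `WeilFormatC.farBlock_ge_dhat`).  Every later kernel certificate (route K2 v2, v3, …) thus yields
its prime-form bound in three lines; `primeCoeff_form_ge_joint` is the instance `A = 2387/1000`.  Proof = the proof of
`primeCoeff_form_ge_joint` with the certificate replaced by the hypothesis.  Standard axioms only; no definitions.
-/

set_option autoImplicit false
set_option linter.dupNamespace false

noncomputable section

open Complex Set MeasureTheory Finset
open scoped Real ComplexConjugate BigOperators ArithmeticFunction.vonMangoldt

namespace Summit.RiemannHypothesis.RiemannHypothesis.Theorems.WeilFormatC

open Literature.NumberTheory.LFunctions Literature.NumberTheory.LFunctions.Yoshida1992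

section Of

variable {a : ℝ} {f : ℝ → ℂ}

/-- **Joint shift bound for a complex window function from a real one.**  If the real five-term joint shift bound
holds on `[−a, a]` with constant `A`, then for every complex window function `f`:
`Σ_{n=2,3,4,5,7} 2Λ(n)/√n · Re∫ f(x+log n) conj f(x) dx ≤ A · ∫‖f‖²` (real and imaginary parts). -/
theorem joint_re_integral_shift_le_of {A : ℝ}
    (hJ : ∀ (u : ℝ → ℝ) (C : ℝ), Measurable u → (∀ x, |u x| ≤ C) → (∀ x, x ∉ Icc (-a) a → u x = 0) →
      2 * (Real.log 2 / Real.sqrt 2) * (∫ x, u (x - Real.log 2) * u x) +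
        2 * (Real.log 3 / Real.sqrt 3) * (∫ x, u (x - Real.log 3) * u x) +
        2 * (Real.log 2 / 2) * (∫ x, u (x - 2 * Real.log 2) * u x) +
        2 * (Real.log 5 / Real.sqrt 5) * (∫ x, u (x - Real.log 5) * u x) +
        2 * (Real.log 7 / Real.sqrt 7) * (∫ x, u (x - Real.log 7) * u x) ≤ A * ∫ x, u x ^ 2)
    (hf : IsWindowFunction a f) :
    2 * (Real.log 2 / Real.sqrt 2) * (∫ x, f (x + Real.log 2) * conj (f x)).re +
      2 * (Real.log 3 / Real.sqrt 3) * (∫ x, f (x + Real.log 3) * conj (f x)).re +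
      2 * (Real.log 2 / 2) * (∫ x, f (x + 2 * Real.log 2) * conj (f x)).re +
      2 * (Real.log 5 / Real.sqrt 5) * (∫ x, f (x + Real.log 5) * conj (f x)).re +
      2 * (Real.log 7 / Real.sqrt 7) * (∫ x, f (x + Real.log 7) * conj (f x)).re
      ≤ A * ∫ x, ‖f x‖ ^ 2 := by
  obtain ⟨S, hS0, hS⟩ := hf.bounded'
  have hre : ∀ x, |(f x).re| ≤ S := fun x ↦ (Complex.abs_re_le_norm _).trans (hS x)
  have him : ∀ x, |(f x).im| ≤ S := fun x ↦ (Complex.abs_im_le_norm _).trans (hS x)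
  have hmr : Measurable fun x ↦ (f x).re := Complex.measurable_re.comp hf.measurable
  have hmi : Measurable fun x ↦ (f x).im := Complex.measurable_im.comp hf.measurable
  have hzr : ∀ x, x ∉ Icc (-a) a → (f x).re = 0 := fun x hx ↦ by rw [hf.eq_zero x hx, Complex.zero_re]
  have hzi : ∀ x, x ∉ Icc (-a) a → (f x).im = 0 := fun x hx ↦ by rw [hf.eq_zero x hx, Complex.zero_im]
  have hu := hJ (fun y ↦ (f y).re) S hmr hre hzr
  have hv := hJ (fun y ↦ (f y).im) S hmi him hzi
  have hsplit : ∀ t : ℝ, (∫ x, f (x + t) * conj (f x)).re =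
      (∫ x, (fun y ↦ (f y).re) (x - t) * (fun y ↦ (f y).re) x) +
        ∫ x, (fun y ↦ (f y).im) (x - t) * (fun y ↦ (f y).im) x := by
    intro t
    rw [re_integral_shift_mul_conj hf t,
      integral_add (integrable_shift_mul_of_window hmr hre hmr hre hzr t)
        (integrable_shift_mul_of_window hmi him hmi him hzi t)]
    simp only
    rw [integral_shift_add_mul_eq_sub (fun y ↦ (f y).re) t, integral_shift_add_mul_eq_sub (fun y ↦ (f y).im) t]
  rw [hsplit, hsplit, hsplit, hsplit, hsplit, integral_norm_sq_eq_add hf]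
  simp only at hu hv ⊢
  nlinarith [hu, hv]

/-- **PRIME ⪰ −A·1 on every finite set of modes, for every window `0 < a ≤ 10397/10000` and every constant `A` of a
real five-term joint shift bound on `[−a, a]`.**
`−A·Σ_{n∈s}|c_n|² ≤ Σ_{n,m∈s} Re(conj c_n c_m)·primeCoeff a n m` (hypothesis `hP` of `WeilFormatC.farBlock_ge_dhat`). -/
theorem primeCoeff_form_ge_of_jointShiftBound (ha : 0 < a) (ha' : a ≤ 10397 / 10000) {A : ℝ}
    (hJ : ∀ (u : ℝ → ℝ) (C : ℝ), Measurable u → (∀ x, |u x| ≤ C) → (∀ x, x ∉ Icc (-a) a → u x = 0) →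
      2 * (Real.log 2 / Real.sqrt 2) * (∫ x, u (x - Real.log 2) * u x) +
        2 * (Real.log 3 / Real.sqrt 3) * (∫ x, u (x - Real.log 3) * u x) +
        2 * (Real.log 2 / 2) * (∫ x, u (x - 2 * Real.log 2) * u x) +
        2 * (Real.log 5 / Real.sqrt 5) * (∫ x, u (x - Real.log 5) * u x) +
        2 * (Real.log 7 / Real.sqrt 7) * (∫ x, u (x - Real.log 7) * u x) ≤ A * ∫ x, u x ^ 2)
    (s : Finset ℤ) (c : ℤ → ℂ) :
    -(A * ∑ n ∈ s, ‖c n‖ ^ 2) ≤ ∑ n ∈ s, ∑ m ∈ s, (conj (c n) * c m).re * primeCoeff a n m := by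
  set f : ℝ → ℂ := ∑ n ∈ s, c n • chi a n with hfdef
  have hf : IsWindowFunction a f := IsWindowFunction.sum s c fun n _ ↦ isWindowFunction_chi ha n
  set X : ℕ → ℝ := fun k ↦ 2 * (∫ x, f (x + Real.log k) * conj (f x)).re with hXdef
  -- the prime form as a sum over shift lengths
  have e : ∑ n ∈ s, ∑ m ∈ s, (conj (c n) * c m).re * primeCoeff a n m
      = ∑ k ∈ weilPrimeIndex a, -((Λ k : ℝ) / Real.sqrt k * X k) := by
    calc ∑ n ∈ s, ∑ m ∈ s, (conj (c n) * c m).re * primeCoeff a n m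
        = ∑ n ∈ s, ∑ m ∈ s, ∑ k ∈ weilPrimeIndex a, (Λ k : ℝ) / Real.sqrt k *
            ((conj (c n) * c m).re * (incrCoeff a (Real.log k) n m - if n = m then 2 else 0)) := by
          refine Finset.sum_congr rfl fun n _ ↦ Finset.sum_congr rfl fun m _ ↦ ?_
          rw [primeCoeff, Finset.mul_sum]
          refine Finset.sum_congr rfl fun k _ ↦ by ring
      _ = ∑ n ∈ s, ∑ k ∈ weilPrimeIndex a, ∑ m ∈ s, (Λ k : ℝ) / Real.sqrt k *
            ((conj (c n) * c m).re * (incrCoeff a (Real.log k) n m - if n = m then 2 else 0)) :=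
          Finset.sum_congr rfl fun n _ ↦ Finset.sum_comm
      _ = ∑ k ∈ weilPrimeIndex a, ∑ n ∈ s, ∑ m ∈ s, (Λ k : ℝ) / Real.sqrt k *
            ((conj (c n) * c m).re * (incrCoeff a (Real.log k) n m - if n = m then 2 else 0)) :=
          Finset.sum_comm
      _ = ∑ k ∈ weilPrimeIndex a, (Λ k : ℝ) / Real.sqrt k *
            ∑ n ∈ s, ∑ m ∈ s, (conj (c n) * c m).re * (incrCoeff a (Real.log k) n m - if n = m then 2 else 0) := by
          refine Finset.sum_congr rfl fun k _ ↦ ?_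
          rw [Finset.mul_sum]
          refine Finset.sum_congr rfl fun n _ ↦ ?_
          rw [Finset.mul_sum]
      _ = ∑ k ∈ weilPrimeIndex a, -((Λ k : ℝ) / Real.sqrt k * X k) := by
          refine Finset.sum_congr rfl fun k hk ↦ ?_
          by_cases hΛ : (Λ k : ℝ) = 0
          · rw [hΛ]; simp
          have hk2 : 2 ≤ k := by
            by_contra h
            have : k = 0 ∨ k = 1 := by omega
            rcases this with rfl | rfl
            · exact hΛ (by simp)
            · exact hΛ (by simp)
          have ht : 0 < Real.log k := Real.log_pos (by exact_mod_cast hk2)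
          have ht2 : Real.log k ≤ 2 * a := (mem_weilPrimeIndex.1 hk).le
          rw [sum_sum_re_mul_incrCoeff_sub_two_eq ha s c ht.le ht2, hXdef]
          ring
  -- terms with `log k ≥ 2a` vanish (the shift is invisible on the window)
  have hXzero : ∀ k : ℕ, 2 * a ≤ Real.log k → X k = 0 := by
    intro k hk
    obtain ⟨S, hS0, hS⟩ := hf.bounded'
    have hre : ∀ x, |(f x).re| ≤ S := fun x ↦ (Complex.abs_re_le_norm _).trans (hS x)
    have him : ∀ x, |(f x).im| ≤ S := fun x ↦ (Complex.abs_im_le_norm _).trans (hS x)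
    have hmr : Measurable fun x ↦ (f x).re := Complex.measurable_re.comp hf.measurable
    have hmi : Measurable fun x ↦ (f x).im := Complex.measurable_im.comp hf.measurable
    have hzr : ∀ x, x ∉ Icc (-a) a → (f x).re = 0 := fun x hx ↦ by rw [hf.eq_zero x hx, Complex.zero_re]
    have hzi : ∀ x, x ∉ Icc (-a) a → (f x).im = 0 := fun x hx ↦ by rw [hf.eq_zero x hx, Complex.zero_im]
    simp only [hXdef]
    rw [re_integral_shift_mul_conj hf,
      integral_add (integrable_shift_mul_of_window hmr hre hmr hre hzr _)
        (integrable_shift_mul_of_window hmi him hmi him hzi _)]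
    rw [integral_shift_add_mul_eq_sub (fun y ↦ (f y).re), integral_shift_add_mul_eq_sub (fun y ↦ (f y).im),
      integral_shift_mul_eq_zero_of_le hzr hk, integral_shift_mul_eq_zero_of_le hzi hk]
    ring
  have hsum : ∑ k ∈ weilPrimeIndex a, -((Λ k : ℝ) / Real.sqrt k * X k) =
      ∑ k ∈ Finset.range 8, -((Λ k : ℝ) / Real.sqrt k * X k) :=
    sum_weilPrimeIndex_eq_sum_range_eight ha' _ fun k hk ↦ by rw [hXzero k hk, mul_zero, neg_zero]
  -- evaluate the sum over `k < 8`
  obtain ⟨hΛ0, hΛ1, hΛ2, hΛ3, hΛ4, hΛ5, hΛ6, hΛ7⟩ := vonMangoldt_values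
  have hs4 : Real.sqrt ((4 : ℕ) : ℝ) = 2 := by
    rw [show ((4 : ℕ) : ℝ) = 2 ^ 2 by norm_num, Real.sqrt_sq (by norm_num)]
  have hjoint := joint_re_integral_shift_le_of hJ hf
  have hnorm := integral_norm_sq_sum_smul_chi ha s c
  rw [e, hsum]
  simp only [Finset.sum_range_succ, Finset.sum_range_zero, hΛ0, hΛ1, hΛ2, hΛ3, hΛ4, hΛ5, hΛ6, hΛ7,
    zero_div, zero_mul, neg_zero, zero_add, add_zero, hs4, hXdef]
  rw [← hnorm]
  have h4 : Real.log ((4 : ℕ) : ℝ) = 2 * Real.log 2 := by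
    rw [show ((4 : ℕ) : ℝ) = 2 ^ 2 by norm_num, Real.log_pow]; norm_num
  simp only [Nat.cast_ofNat] at h4 ⊢
  rw [h4]
  nlinarith [hjoint]

end Of

end Summit.RiemannHypothesis.RiemannHypothesis.Theorems.WeilFormatC
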